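import Summits.CriticalPhenomena.CardyFormulaZ2.Theorems.CardySelfDualSegmentUniformMarginalityPointwiseBoxCrossing
import Summits.CriticalPhenomena.CardyFormulaZ2.Theorems.CardySelfDualSegmentUniformMarginalityStubCrudeLeLrCrossing
import Summits.CriticalPhenomena.CardyFormulaZ2.Theorems.CardySelfDualSegmentUniformMarginalityStubPointwiseRender
import Summits.CriticalPhenomena.CardyFormulaZ2.Theorems.CardySelfDualSegmentSegmentClosed
import HarnessLib

/-!
# The route's `Target` forces POINTWISE box crossing; with marginality at one rectangle it forces
# `UniformBoxCrossing` (crux `UniformMarginality`, stmt-CriticalPhenomena-5472, line `Sketch`; lead c11)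

Companion of `…UniformMarginalityPointwiseBoxCrossing.lean` (the t-uniformity merger).  There, marginality at the
one tall rectangle `Q₀ = (0,1) × (0,4)` upgrades POINTWISE box crossing of the single corner models
`M_t = cornerPercolation t` to the route crux `UniformBoxCrossing`.  Here we record that pointwise box crossing is
itself a CONSEQUENCE OF THE ROUTE'S TARGET (linear universality along the segment): if `CardyMod t α` holds for
some `α ∈ ℍ` — the crude `M_t`-crossing probabilities of every conformal rectangle `R'` converge to Cardy's value of
the sheared rectangle `φ_α R'` — then every model rectangle `(0,1) × (0,H)` is crossed bottom-to-top with
probability eventually `≥ c(t,H) > 0` (Cardy values lie in `(0,1)`), the forced-gate sandwich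
`stub_crudeLeLrCrossing` turns this into lower bounds for the hard-way crossings of lattice rectangles of every
bounded aspect ratio, and the pointwise render `stub_pointwiseRender` (self-duality for the upper bounds,
Grimmett–Manolescu's sandwich for the drawing on `√2 ℤ²`) gives `HasBoxCrossingProperty (cornerPercolation t)`.

Consequences:
* `hasBoxCrossingProperty_of_target` : `Target → ∀ t, HasBoxCrossingProperty (cornerPercolation t) squareLatticeEmbedding.z`;
* `uniformBoxCrossing_of_target_of_uniformMarginality` : `Target → UniformMarginality → UniformBoxCrossing` — given the
  crux `UniformMarginality`, the crux `UniformBoxCrossing` (stmt-5476) is NECESSARY for the route's own `Target`: it can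
  fail only if the thesis or quantitative marginality fails (answering 5476's "may be FALSE … or non-uniform in t");
* `uniformBoxCrossing_of_integratedBoundRectilinear_of_target` : stub (B₁) → `Target` → `UniformBoxCrossing`
  (through `uniformMarginality_of_rectilinear_of_target`, p137344).
-/

noncomputable section

open Set Filter Metric MeasureTheory Complex
open scoped Topology
open Literature.Probability.RandomPlanarGeometry Literature.Probability.Percolation
open Literature.Probability.LatticeModels Literature.Barriers.CriticalPhenomena
open Summit.CriticalPhenomena.CardyFormulaZ2.Cruxes.UniformBoxCrossing.NonSlantLine
open Summit.CriticalPhenomena.CardyFormulaZ2.Theorems.RectilinearCardy.Negative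
  (cardyFunction_modulus_mem_Ioo crossRatio_eq_modulus)

namespace Summit.CriticalPhenomena.CardyFormulaZ2.Cruxes.UniformMarginality.HeatFlow

/-! ### Cardy limits along the segment give eventual positive lower bounds for every conformal rectangle -/

/-- **`CardyMod t α` gives every conformal rectangle a crude crossing limit in `(0,1)`**: shear the test domain
forward by `φ_α` (`MarkedDomain.map (shearHomeomorph α)`), uniformize the image by its modulus datum, and read off
Cardy's value, which lies in `(0,1)` (`cardyFunction_modulus_mem_Ioo`). -/
theorem exists_tendsto_cornerCrossingProb_of_cardyMod {t : unitInterval} {α : ℂ} (hα : 0 < α.im)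
    (hmod : ∀ (R R' : ConformalRectangle) (φ : ConformalEquiv UpperHalfPlane.upperHalfPlaneSet R.carrier)
      (x : Fin 4 → ℝ), R.carrier = moduliShear α '' R'.carrier →
      (∀ i, R.pt i = moduliShear α (R'.pt i)) → R.IsUniformizing φ x →
      Tendsto (cornerCrossingProb t R') (𝓝[>] 0)
        (𝓝 (Literature.Probability.RandomPlanarGeometry.cardyFunction
          (Literature.Probability.RandomPlanarGeometry.crossRatio x))))
    (R' : ConformalRectangle) :
    ∃ L ∈ Ioo (0 : ℝ) 1, Tendsto (cornerCrossingProb t R') (𝓝[>] 0) (𝓝 L) := by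
  obtain ⟨φ, x, hφ⟩ := MarkedDomain.exists_isUniformizing_holds (R'.map (shearHomeomorph α hα.ne'))
  refine ⟨_, ?_, hmod _ R' φ x ?_ (fun i => ?_) hφ⟩
  · rw [crossRatio_eq_modulus hφ]
    exact cardyFunction_modulus_mem_Ioo _
  · rw [MarkedDomain.carrier_map, coe_shearHomeomorph]
  · rw [MarkedDomain.pt_map, coe_shearHomeomorph]

/-- **Eventual positive lower bound at the meshes `1/m`.** Under `CardyMod t α`, for every conformal rectangle
`R'` there are `c > 0` and `m₀` with `c ≤ P_t(R', 1/m)` for all `m ≥ m₀`. -/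
theorem exists_le_cornerCrossingProb_of_cardyMod {t : unitInterval} {α : ℂ} (hα : 0 < α.im)
    (hmod : ∀ (R R' : ConformalRectangle) (φ : ConformalEquiv UpperHalfPlane.upperHalfPlaneSet R.carrier)
      (x : Fin 4 → ℝ), R.carrier = moduliShear α '' R'.carrier →
      (∀ i, R.pt i = moduliShear α (R'.pt i)) → R.IsUniformizing φ x →
      Tendsto (cornerCrossingProb t R') (𝓝[>] 0)
        (𝓝 (Literature.Probability.RandomPlanarGeometry.cardyFunction
          (Literature.Probability.RandomPlanarGeometry.crossRatio x))))
    (R' : ConformalRectangle) :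
    ∃ c : ℝ, 0 < c ∧ ∃ m₀ : ℕ, ∀ m : ℕ, m₀ ≤ m → c ≤ cornerCrossingProb t R' (1 / (m : ℝ)) := by
  obtain ⟨L, hL, hlim⟩ := exists_tendsto_cornerCrossingProb_of_cardyMod hα hmod R'
  -- eventually (δ → 0⁺) the crossing probability exceeds `L/2`
  have hev : ∀ᶠ δ in 𝓝[>] (0 : ℝ), L / 2 < cornerCrossingProb t R' δ :=
    hlim.eventually (lt_mem_nhds (by linarith [hL.1]))
  rw [Filter.Eventually, mem_nhdsGT_iff_exists_Ioo_subset] at hev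
  obtain ⟨δ₀, hδ₀, hsub⟩ := hev
  obtain ⟨m₀, hm₀⟩ := exists_nat_gt (1 / δ₀)
  have hδ₀' : (0 : ℝ) < δ₀ := hδ₀
  refine ⟨L / 2, by linarith [hL.1], m₀, fun m hm => ?_⟩
  have hm' : (1 / δ₀ : ℝ) < m := hm₀.trans_le (by exact_mod_cast hm)
  have hmpos : (0 : ℝ) < m := lt_trans (by positivity) hm'
  refine le_of_lt (hsub ⟨by positivity, ?_⟩)
  rw [div_lt_iff₀ hmpos]
  rw [div_lt_iff₀ hδ₀'] at hm'
  linarith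

/-! ### Lattice lower bounds at every aspect ratio, then the box-crossing property -/

/-- **`CardyMod t α` gives hard-way lower bounds for lattice rectangles of every bounded aspect ratio**:
for every `k` there are `c > 0`, `n₀` with `c ≤ M_t(LR([0,M] × [0,N]))` whenever `N ≥ n₀` and `M ≤ k N` — the
eventual lower bound for the model rectangle `(0,1) × (0, 2k+2)` at mesh `1/m`, `m = ⌊7N/5⌋`, pushed into the
lattice by the forced-gate sandwich `stub_crudeLeLrCrossing`. -/
theorem latticeLowerBounds_of_cardyMod {t : unitInterval} {α : ℂ} (hα : 0 < α.im)
    (hmod : ∀ (R R' : ConformalRectangle) (φ : ConformalEquiv UpperHalfPlane.upperHalfPlaneSet R.carrier)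
      (x : Fin 4 → ℝ), R.carrier = moduliShear α '' R'.carrier →
      (∀ i, R.pt i = moduliShear α (R'.pt i)) → R.IsUniformizing φ x →
      Tendsto (cornerCrossingProb t R') (𝓝[>] 0)
        (𝓝 (Literature.Probability.RandomPlanarGeometry.cardyFunction
          (Literature.Probability.RandomPlanarGeometry.crossRatio x)))) :
    ∀ k : ℕ, ∃ c : ℝ, 0 < c ∧ ∃ n₀ : ℕ, ∀ M N : ℕ, n₀ ≤ N → M ≤ k * N →
      c ≤ (cornerPercolation t).real (lrCrossing M N) := by
  intro k
  have hk : (0 : ℝ) < 2 * (k : ℝ) + 2 := by positivity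
  obtain ⟨c, hc, m₀, hm₀⟩ :=
    exists_le_cornerCrossingProb_of_cardyMod hα hmod (rectQuad 0 1 0 (2 * (k : ℝ) + 2) one_pos hk)
  refine ⟨c, hc, m₀ + k + 8, fun M N hN hM => ?_⟩
  -- the mesh `1/m`, `m = ⌊7N/5⌋`
  set m : ℕ := 7 * N / 5 with hm_def
  have h₂ : 5 * m ≤ 7 * N := by omega
  have h₁ : 3 * M + 16 ≤ (4 * k + 4) * m := by
    have h5m : 7 * N ≤ 5 * m + 4 := by omega
    have hkm : (4 * k + 4) * m = 4 * (k * m) + 4 * m := by ring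
    have hkN : M ≤ k * N := hM
    have : 3 * (k * N) + 16 ≤ 4 * (k * m) + 4 * m := by
      have hNm : N ≤ m := by omega
      have : k * N ≤ k * m := Nat.mul_le_mul_left k hNm
      nlinarith
    omega
  have hmm₀ : m₀ ≤ m := by omega
  exact (hm₀ m hmm₀).trans (stub_crudeLeLrCrossing t k M N m hk h₁ h₂)

/-- **`CardyMod t α` for some `α ∈ ℍ` ⟹ the single model `M_t` has the box-crossing property**
(`stub_pointwiseRender`: upper bounds by self-duality, drawing on `√2 ℤ²` by the Grimmett–Manolescu sandwich). -/
theorem hasBoxCrossingProperty_of_cardyMod {t : unitInterval} {α : ℂ} (hα : 0 < α.im)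
    (hmod : ∀ (R R' : ConformalRectangle) (φ : ConformalEquiv UpperHalfPlane.upperHalfPlaneSet R.carrier)
      (x : Fin 4 → ℝ), R.carrier = moduliShear α '' R'.carrier →
      (∀ i, R.pt i = moduliShear α (R'.pt i)) → R.IsUniformizing φ x →
      Tendsto (cornerCrossingProb t R') (𝓝[>] 0)
        (𝓝 (Literature.Probability.RandomPlanarGeometry.cardyFunction
          (Literature.Probability.RandomPlanarGeometry.crossRatio x)))) :
    HasBoxCrossingProperty (cornerPercolation t) squareLatticeEmbedding.z :=
  stub_pointwiseRender t (latticeLowerBounds_of_cardyMod hα hmod)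

/-! ### Consequences for the route -/

open Summit.CriticalPhenomena.CardyFormulaZ2.Theses.CardySelfDualSegment

/-- **The route's `Target` forces the box-crossing property of every single `M_t`** (the route's `P t R δ` is
`cornerCrossingProb t R δ` by `rfl`). -/
theorem hasBoxCrossingProperty_of_target (hT : Target) (t : unitInterval) :
    HasBoxCrossingProperty (cornerPercolation t) squareLatticeEmbedding.z := by
  obtain ⟨α, hα, hmod⟩ := hT t
  exact hasBoxCrossingProperty_of_cardyMod hα hmod

/-- **Registered form** (sub-goal `stub_targetGivesPointwise` of stmt-CriticalPhenomena-5472, line `Sketch`): the route's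
`Target` forces the box-crossing property of every single corner model `M_t`. -/
theorem stub_targetGivesPointwise : Target → ∀ t : unitInterval, HasBoxCrossingProperty (cornerPercolation t) squareLatticeEmbedding.z :=
  hasBoxCrossingProperty_of_target

/-- **`Target` + marginality at the one tall rectangle `Q₀ = (0,1) × (0,4)` ⟹ `UniformBoxCrossing`** (the merger
`uniformBoxCrossing_of_marginalityAt_of_pointwise`). -/
theorem uniformBoxCrossing_of_target_of_marginalityAt (hT : Target)
    (hUM : ∀ (t₀ : unitInterval) (ε : ℝ), 0 < ε → ∃ η > 0, ∀ t : unitInterval, dist t t₀ < η →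
      ∀ δ : ℝ, 0 < δ → |cornerCrossingProb t (rectQuad 0 1 0 4 one_pos four_pos) δ -
        cornerCrossingProb t₀ (rectQuad 0 1 0 4 one_pos four_pos) δ| < ε) :
    UniformBoxCrossing :=
  uniformBoxCrossing_of_marginalityAt_of_pointwise hUM (hasBoxCrossingProperty_of_target hT)

/-- **`Target → UniformMarginality → UniformBoxCrossing`**: given quantitative marginality, the crux
`UniformBoxCrossing` (stmt-CriticalPhenomena-5476) is NECESSARY for the route's own target. -/
theorem uniformBoxCrossing_of_target_of_uniformMarginality (hT : Target) (hUM : UniformMarginality) :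
    UniformBoxCrossing :=
  uniformBoxCrossing_of_uniformMarginality_of_pointwise hUM (hasBoxCrossingProperty_of_target hT)

/-- **Stub (B₁) + `Target` ⟹ `UniformBoxCrossing`** (via `uniformMarginality_of_rectilinear_of_target`, p137344:
(B₁) and the target give the crux `UniformMarginality`). -/
theorem uniformBoxCrossing_of_integratedBoundRectilinear_of_target
    (hB₁ : ∀ R : ConformalRectangle,
      (∃ S : Finset (ℂ × ℂ), (∀ p ∈ S, p.1.re = p.2.re ∨ p.1.im = p.2.im) ∧
        frontier R.carrier ⊆ ⋃ p ∈ S, segment ℝ p.1 p.2) →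
      ∀ t₀ : ℝ, t₀ ∈ Set.Icc (0 : ℝ) 1 → ∀ ε > 0, ∃ η > 0,
        ∀ δ : ℝ, 0 < δ → ∀ t ∈ Set.Icc (0 : ℝ) 1, |t - t₀| < η → |Pext R δ t - Pext R δ t₀| < ε)
    (hT : Target) : UniformBoxCrossing :=
  uniformBoxCrossing_of_target_of_uniformMarginality hT (uniformMarginality_of_rectilinear_of_target hB₁ hT)

end Summit.CriticalPhenomena.CardyFormulaZ2.Cruxes.UniformMarginality.HeatFlow

end
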